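import Literature.AlgebraicGeometry.HodgeTheory.BettiKunnethPieceHodgeClassesHomIntegerTwist
import Literature.AlgebraicGeometry.HodgeTheory.BettiHodgeConjectureSquareOffMiddleAlgebraic
import Literature.AlgebraicGeometry.HodgeTheory.ProductFactorsHodgeDescent
import HarnessLib

/-!
# `HC(Y × Z)` for ALL smooth projective `Y` (`dim m`), `Z` (`dim n`): the REDUCED window — given `HC(Y)`, `HC(Z)`, only the pieces `Hⁱ(Y) ⊗ Hʲ(Z)`, `1 ≤ i ≤ m`, `1 ≤ j ≤ n`, `i + j = 2c ≥ 4`, with BOTH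
# factors non-zero and NEITHER factor consisting of Hodge classes impose a condition (per piece, and per morphism of Hodge structures `φ : H^{2n−j}(Z) → Hⁱ(Y)(c − n)`)
# (Voisin I §11.3.3 Thm. 11.38–11.40, Lemma 11.41, pp. 285–287; Thm. 11.30; §7.3.2 Lemma 7.28; Deligne Hodge II 2.1.13; Voisin II Prop. 9.20; Voisin 2025 §3.2.1; Arapura Lemma 4.2)

Family `hodge`, lane `lit-hodgefound` (Track 2 foundations library; Layers A1/A4), layer `Literature/AlgebraicGeometry/HodgeTheory`.  THEOREMS ONLY (no definition, no named fact, no instance;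
D-0026 net debt `0`).  Refines the window of the tree's assembly `BettiUniverse.hodgeConjectureFor_tensor_of_kunneth_pieces_pos_le` (and of the seat's g31-#11): inside the window `1 ≤ i ≤ m`,
`1 ≤ j ≤ n` a piece `Hⁱ(Y) ⊗ Hʲ(Z) ⊂ H^{2c}(Y × Z)` is still FREE when a factor vanishes (the piece is `0`; tree `…_of_finrank_eq_zero`) or when a factor consists of Hodge classes — `i = 2a` with
`Hdgᵃ(H^{2a}(Y)) = H^{2a}(Y;ℚ)` (or `j = 2b` with `Hdgᵇ(H^{2b}(Z)) = H^{2b}(Z;ℚ)`): then the Hodge classes of the piece are `H^{2a}(Y) ⊗ Hdgᵇ(H^{2b}(Z))` (Deligne 2.1.13) and their cross products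
`pr₁^* u ∪ pr₂^* w` are algebraic by `HC(Y)`, `HC(Z)` (tree `…_of_hodgeClasses_eq_top_left/right`).  This is the mechanism behind the hypersurface and "off-middle algebraic" criteria of the lane
(`H^{2a}(Y) = ℚ·ηᵃ` off the middle degree); here it is stated for arbitrary factors, piece by piece: the per-piece condition «`crossMap t ⊗ 1` algebraic for the Hodge classes `t`» — equivalently
(Lemma 11.41 with integer twists, g31-#2; faithfulness of the action of a piece, g30) «every `φ ∈ Hom_HS(H^{2n−j}(Z), Hⁱ(Y)(c − n))` is induced by some `crossMap t` with `crossMap t ⊗ 1` algebraic» —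
is needed only on the REDUCED window: `bᵢ(Y) ≠ 0`, `bⱼ(Z) ≠ 0`, `Hdg(Hⁱ(Y)) ≠ Hⁱ(Y;ℚ)` if `i` is even, `Hdg(Hʲ(Z)) ≠ Hʲ(Z;ℚ)` if `j` is even.

WHAT IS PROVED.
* §1 **`BettiUniverse.hodgeConjectureFor_tensor_iff_forall_kunneth_pieces_reducedWindow_algebraic`** — given `HC(Y)`, `HC(Z)`: `HC(Y × Z)` ⟺ the per-piece condition on the reduced window.
* §2 (complex orientations) **`BettiUniverse.hodgeConjectureFor_tensor_iff_forall_hom_reducedWindow_exists_crossMap_algebraic`** — given `HC(Y)`, `HC(Z)`: `HC(Y × Z)` ⟺ on the reduced window every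
  `φ : H^{2n−j}(Z) → Hⁱ(Y)(c − n)` is induced by some `crossMap t`, `t ∈ Hⁱ(Y;ℚ) ⊗ Hʲ(Z;ℚ)`, with `crossMap t ⊗ 1` algebraic.
* §3 **`BettiUniverse.hodgeConjectureFor_tensor_iff_factors_and_forall_hom_reducedWindow_exists_crossMap_algebraic`** — `HC(Y × Z)` ⟺ `HC(Y) ∧ HC(Z) ∧` the criterion of §2.

THE PRINTS.  C. Voisin (2002) [VoisinHodgeI2002] §6.2.3 Thm. 6.25; §7.3.1 Def. 7.22; §7.3.2 Lemma 7.28, Rem. 7.29; §11.3.1 Thm. 11.30; §11.3.3 Thm. 11.38–11.40, Lemma 11.41 and pp. 285–287.  P. Deligne (1971)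
[DeligneHodgeII1971] 2.1.13.  C. Voisin (2003) [VoisinHodgeII2003] §9.2.4 Prop. 9.20 and its proof.  C. Voisin (2025) [Voisin2025] §3.2.1 (12)–(14), Prop. 3.8, Cor. 3.9.  D. Arapura (2006) [Arapura2006]
§4 Lemma 4.2, §1 Cor. 1.2.  A. Hatcher (2002) [HatcherAT2002] §3.2 Thm. 3.15–3.16.  P. Deligne (2000/2006) [Deligne2000] §1.

THE OBJECTS (all the tree's).  `BettiUniverse.kunnethSummand`, `BettiUniverse.crossMap`, `BettiUniverse.hodge`, `corrAction complexOrientationFamily`, `HodgeStructure.Hom`, `tateTwist` (`r : ℤ`), `cast`,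
`hodgeClasses`, `ofRatClass`, `algebraicClasses`, `bettiCohomology`, `Module.finrank`, `HodgeConjectureFor`; the tree's `BettiUniverse.hodgeConjectureFor_tensor_of_kunneth_pieces_pos_le`,
`BettiUniverse.ofRatClass_crossMap_mem_algebraicClasses_of_hodgeClasses_eq_top_left/right`, `BettiUniverse.ofRatClass_crossMap_mem_algebraicClasses_of_finrank_eq_zero`, `BettiUniverse.crossMap_mem_hodgeClasses`,
g31-#2 `BettiUniverse.exists_hom_tateTwist_int_of_mem_hodgeClasses_kunnethSummand`, `BettiUniverse.exists_mem_hodgeClasses_corrAction_crossMap_eq_ofRatClass_hom_int`, g30 `BettiUniverse.corrAction_crossMap_injective`,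
`BettiUniverse.span_range_ofRatClass_eq_top`, `hodgeConjectureFor_of_tensor_left/right`, `IsSmoothProjective.tensor_holds`.

DEVIATIONS / SCOPE.  Complex orientations in §2–§3.  No definitions.

## References
* [VoisinHodgeI2002] C. Voisin, *Hodge Theory and Complex Algebraic Geometry I* (2002) — §6.2.3 Thm. 6.25; §7.3.1 Def. 7.22; §7.3.2 Lemma 7.28, Rem. 7.29; §11.3.1 Thm. 11.30; §11.3.3 Thm. 11.38–11.40, Lemma 11.41, pp. 285–287.
* [DeligneHodgeII1971] P. Deligne, *Théorie de Hodge II* (1971) — 2.1.13.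
* [VoisinHodgeII2003] C. Voisin, *Hodge Theory and Complex Algebraic Geometry II* (2003) — §9.2.4 Prop. 9.20.
* [Voisin2025] C. Voisin, *Cycle classes on algebraic varieties* (2025) — §3.2.1 (12)–(14), Prop. 3.8, Cor. 3.9.
* [Arapura2006] D. Arapura, *Motivation for Hodge cycles* (2006) — §4 Lemma 4.2, §1 Cor. 1.2.
* [HatcherAT2002] A. Hatcher, *Algebraic Topology* (2002) — §3.2 Thm. 3.15–3.16.
* [Deligne2000] P. Deligne, *The Hodge conjecture* (Clay problem description) — §1.

## Provenance
Lane `lit-hodgefound` (Hodge path, Track 2), prover seat `lit-hodgefound-p29` (generation 31), self-proposed row g31-#14 (two factors of arbitrary dimensions: the reduced window — non-zero,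
non-pure pieces only).
-/

noncomputable section

open scoped TensorProduct
open CategoryTheory MonoidalCategory CartesianMonoidalCategory Module Finset
open Literature.AlgebraicTopology.SingularHomology
open Literature.Geometry.Kaehler

namespace Literature.AlgebraicGeometry.HodgeTheory

open Literature.AlgebraicGeometry.Motives
open Literature.AlgebraicGeometry.Motives.HodgeStructure

variable {m n d : ℕ} {Y Z : SchemeOver ℂ}

variable [HodgeTensorFacts.{0, 0}]

/-! ### §1 The reduced window, per Künneth piece -/

/-- **Given `HC(Y)` and `HC(Z)`: `HC(Y × Z)` ⟺ for every piece `Hⁱ(Y) ⊗ Hʲ(Z) ⊂ H^{2c}(Y × Z)` of the REDUCED window — `2 ≤ c`, `1 ≤ i ≤ m`, `1 ≤ j ≤ n`, `bᵢ(Y) ≠ 0`, `bⱼ(Z) ≠ 0`, `Hdgᵃ(H^{2a}(Y)) ≠ H^{2a}(Y;ℚ)`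
when `i = 2a`, `Hdgᵇ(H^{2b}(Z)) ≠ H^{2b}(Z;ℚ)` when `j = 2b` — and every Hodge class `t` of it, `crossMap t ⊗ 1` is algebraic** (the other window pieces are free: a zero factor gives the zero piece, a
factor of Hodge classes gives Hodge classes `H^{2a}(Y) ⊗ Hdgᵇ(H^{2b}(Z))` with algebraic exterior products, Deligne 2.1.13; then the tree's assembly over the window; «⇒»: `crossMap t` is a Hodge class of
`H^{2c}(Y × Z)`, Thm. 11.40). [cite: VoisinHodgeI2002, §11.3.3 Thm. 11.38, Thm. 11.40, Lemma 11.41, p. 287, §11.3.1 Thm. 11.30, §6.2.3 Thm. 6.25] [cite: DeligneHodgeII1971, 2.1.13] [cite: VoisinHodgeII2003, §9.2.4 Prop. 9.20]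
[cite: HatcherAT2002, §3.2 Thm. 3.15–3.16] [cite: Deligne2000, §1] -/
theorem BettiUniverse.hodgeConjectureFor_tensor_iff_forall_kunneth_pieces_reducedWindow_algebraic (hHD : exists_isReal_hodgeModel) (hY : IsSmoothProjective m Y) (hZ : IsSmoothProjective n Z)
    (hYZ : IsSmoothProjective d (Y ⊗ Z)) (hHCY : HodgeConjectureFor m Y) (hHCZ : HodgeConjectureFor n Z) :
    HodgeConjectureFor d (Y ⊗ Z) ↔
      ∀ (c i j : ℕ) (hij : i + j = 2 * c), 1 ≤ i → i ≤ m → 1 ≤ j → j ≤ n → 2 ≤ c →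
        0 < Module.finrank ℚ (bettiCohomology Y i) → 0 < Module.finrank ℚ (bettiCohomology Z j) →
        (∀ a, i = 2 * a → (BettiUniverse.hodge hHD hY (2 * a)).hodgeClasses a ≠ ⊤) → (∀ b, j = 2 * b → (BettiUniverse.hodge hHD hZ (2 * b)).hodgeClasses b ≠ ⊤) →
          ∀ t ∈ (BettiUniverse.kunnethSummand hHD hY hZ (2 * c) ⟨(i, j), HasAntidiagonal.mem_antidiagonal.2 hij⟩).hodgeClasses c,
            ofRatClass (ComplexPoints (Y ⊗ Z)) (2 * c) (BettiUniverse.crossMap Y Z hij t) ∈ algebraicClasses (Y ⊗ Z) c := by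
  have hHCYc : ∀ c' : ℕ, ∀ y ∈ (BettiUniverse.hodge hHD hY (2 * c')).hodgeClasses c', ofRatClass (ComplexPoints Y) (2 * c') y ∈ algebraicClasses Y c' :=
    fun c' y hy ↦ hHCY.2 c' _ (isRationalClass_ofRatClass _) ((BettiUniverse.mem_hodgeClasses_hodge_iff_isOfHodgeType hHD hY c' y).1 hy)
  have hHCZc : ∀ c' : ℕ, ∀ z ∈ (BettiUniverse.hodge hHD hZ (2 * c')).hodgeClasses c', ofRatClass (ComplexPoints Z) (2 * c') z ∈ algebraicClasses Z c' :=
    fun c' z hz ↦ hHCZ.2 c' _ (isRationalClass_ofRatClass _) ((BettiUniverse.mem_hodgeClasses_hodge_iff_isOfHodgeType hHD hZ c' z).1 hz)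
  refine ⟨fun hHC c i j hij _ _ _ _ _ _ _ _ _ t ht ↦ ?_, fun h ↦ BettiUniverse.hodgeConjectureFor_tensor_of_kunneth_pieces_pos_le hHD hY hZ hYZ hHCY hHCZ fun c i j hij hi him hj hjn hc t ht ↦ ?_⟩
  · exact hHC.2 c _ (isRationalClass_ofRatClass _) ((BettiUniverse.mem_hodgeClasses_hodge_iff_isOfHodgeType hHD hYZ c _).1
      (BettiUniverse.crossMap_mem_hodgeClasses hHD hodgePQ_independent_of_hodgeModel_holds hY hZ hYZ hij c ht))
  · -- a zero factor: the piece is zero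
    by_cases h0 : Module.finrank ℚ (bettiCohomology Y i) = 0 ∨ Module.finrank ℚ (bettiCohomology Z j) = 0
    · exact BettiUniverse.ofRatClass_crossMap_mem_algebraicClasses_of_finrank_eq_zero hY hZ hij h0 t
    -- a first factor of Hodge classes
    by_cases hpY : ∃ a, i = 2 * a ∧ (BettiUniverse.hodge hHD hY (2 * a)).hodgeClasses a = ⊤
    · obtain ⟨a, rfl, htop⟩ := hpY
      obtain ⟨b, rfl⟩ : ∃ b, j = 2 * b := ⟨c - a, by omega⟩
      exact BettiUniverse.ofRatClass_crossMap_mem_algebraicClasses_of_hodgeClasses_eq_top_left hHD hY hZ hij htop (fun u ↦ hHCYc a u (by rw [htop]; exact Submodule.mem_top)) (hHCZc b) ht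
    -- a second factor of Hodge classes
    by_cases hpZ : ∃ b, j = 2 * b ∧ (BettiUniverse.hodge hHD hZ (2 * b)).hodgeClasses b = ⊤
    · obtain ⟨b, rfl, htop⟩ := hpZ
      obtain ⟨a, rfl⟩ : ∃ a, i = 2 * a := ⟨c - b, by omega⟩
      exact BettiUniverse.ofRatClass_crossMap_mem_algebraicClasses_of_hodgeClasses_eq_top_right hHD hY hZ hij htop (hHCYc a) (fun w ↦ hHCZc b w (by rw [htop]; exact Submodule.mem_top)) ht
    -- the reduced window
    exact h c i j hij hi him hj hjn hc (Nat.pos_of_ne_zero (not_or.1 h0).1) (Nat.pos_of_ne_zero (not_or.1 h0).2) (fun a hia htop ↦ hpY ⟨a, hia, htop⟩) (fun b hjb htop ↦ hpZ ⟨b, hjb, htop⟩) t ht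

/-! ### §2 The reduced window, per morphism of Hodge structures -/

/-- **Given `HC(Y)` and `HC(Z)`: `HC(Y × Z)` ⟺ on the reduced window (`2 ≤ c`, `1 ≤ i ≤ m`, `1 ≤ j ≤ n`, `i + j = 2c`, `a + j = 2n`, `n + r = c`, `bᵢ(Y) ≠ 0`, `bⱼ(Z) ≠ 0`, no factor of Hodge classes)
every morphism of `ℚ`-Hodge structures `φ : Hᵃ(Z) → Hⁱ(Y)(r)` is induced on `Hᵃ(Z;ℂ)` by some `crossMap t`, `t ∈ Hⁱ(Y;ℚ) ⊗ Hʲ(Z;ℚ)`, with `crossMap t ⊗ 1` algebraic** (complex orientations; §1 and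
Lemma 11.41 with integer twists: «⇒» `t = t_φ`; «⇐» the class provided for `φ_u` acts as the Hodge class `u`, hence equals it). [cite: VoisinHodgeI2002, §7.3.1 Def. 7.22, §7.3.2, §11.3.3 Thm. 11.38–11.40, Lemma 11.41 and pp. 285–287, §11.3.1 Thm. 11.30]
[cite: DeligneHodgeII1971, 2.1.13] [cite: Voisin2025, §3.2.1 (12)–(14), Prop. 3.8 and Cor. 3.9] [cite: Deligne2000, §1] -/
theorem BettiUniverse.hodgeConjectureFor_tensor_iff_forall_hom_reducedWindow_exists_crossMap_algebraic (hHD : exists_isReal_hodgeModel) (hY : IsSmoothProjective m Y) (hZ : IsSmoothProjective n Z)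
    (hYZ : IsSmoothProjective d (Y ⊗ Z)) (hHCY : HodgeConjectureFor m Y) (hHCZ : HodgeConjectureFor n Z) :
    HodgeConjectureFor d (Y ⊗ Z) ↔
      ∀ (c i j a : ℕ) (r : ℤ) (_hc : 2 ≤ c) (_hi : 1 ≤ i) (_him : i ≤ m) (_hj : 1 ≤ j) (_hjn : j ≤ n) (hij : i + j = 2 * c) (_haj : a + j = 2 * n) (hab : a + 2 * c = i + 2 * n)
        (_hr : ((n : ℕ) : ℤ) + r = ((c : ℕ) : ℤ)) (hw : ((i : ℕ) : ℤ) - 2 * r = ((a : ℕ) : ℤ))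
        (_hbY : 0 < Module.finrank ℚ (bettiCohomology Y i)) (_hbZ : 0 < Module.finrank ℚ (bettiCohomology Z j))
        (_hnY : ∀ a', i = 2 * a' → (BettiUniverse.hodge hHD hY (2 * a')).hodgeClasses a' ≠ ⊤) (_hnZ : ∀ b', j = 2 * b' → (BettiUniverse.hodge hHD hZ (2 * b')).hodgeClasses b' ≠ ⊤)
        (φ : HodgeStructure.Hom (BettiUniverse.hodge hHD hZ a) (((BettiUniverse.hodge hHD hY i).tateTwist r).cast hw)),
        ∃ t : bettiCohomology Y i ⊗[ℚ] bettiCohomology Z j, ofRatClass (ComplexPoints (Y ⊗ Z)) (2 * c) (BettiUniverse.crossMap Y Z hij t) ∈ algebraicClasses (Y ⊗ Z) c ∧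
          ∀ v, corrAction complexOrientationFamily hY hZ hab (ofRatClass (ComplexPoints (Y ⊗ Z)) (2 * c) (BettiUniverse.crossMap Y Z hij t)) (ofRatClass (ComplexPoints Z) a v) =
            ofRatClass (ComplexPoints Y) i (φ.toLinearMap v) := by
  rw [BettiUniverse.hodgeConjectureFor_tensor_iff_forall_kunneth_pieces_reducedWindow_algebraic hHD hY hZ hYZ hHCY hHCZ]
  constructor
  · intro h c i j a r hc hi him hj hjn hij haj hab hr hw hbY hbZ hnY hnZ φ
    obtain ⟨t, ht, hφ⟩ := BettiUniverse.exists_mem_hodgeClasses_corrAction_crossMap_eq_ofRatClass_hom_int hHD hY hZ hij haj hab hr hw φ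
    exact ⟨t, h c i j hij hi him hj hjn hc hbY hbZ hnY hnZ t ht, hφ⟩
  · intro h c i j hij hi him hj hjn hc hbY hbZ hnY hnZ u hu
    have haj : (2 * n - j) + j = 2 * n := by omega
    have hab : (2 * n - j) + 2 * c = i + 2 * n := by omega
    have hr : ((n : ℕ) : ℤ) + (((c : ℕ) : ℤ) - ((n : ℕ) : ℤ)) = ((c : ℕ) : ℤ) := by omega
    have hw : ((i : ℕ) : ℤ) - 2 * (((c : ℕ) : ℤ) - ((n : ℕ) : ℤ)) = (((2 * n - j : ℕ)) : ℤ) := by omega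
    obtain ⟨φ, hφ⟩ := BettiUniverse.exists_hom_tateTwist_int_of_mem_hodgeClasses_kunnethSummand hHD hY hZ hij hab hr hw hu
    obtain ⟨t, ht, htφ⟩ := h c i j (2 * n - j) (((c : ℕ) : ℤ) - ((n : ℕ) : ℤ)) hc hi him hj hjn hij haj hab hr hw hbY hbZ hnY hnZ φ
    have e : t = u := BettiUniverse.corrAction_crossMap_injective complexOrientationFamily hY hZ hij haj hab
      (LinearMap.ext_on_range (BettiUniverse.span_range_ofRatClass_eq_top hZ (2 * n - j)) fun v ↦ by rw [htφ v, hφ v])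
    exact e ▸ ht

/-! ### §3 With the factors' conjectures on the right-hand side -/

/-- **`HC(Y × Z)` ⟺ `HC(Y)`, `HC(Z)` and the reduced-window criterion of §2** (the projections are surjective, so `HC(Y × Z) ⟹ HC(Y), HC(Z)`: Voisin I Lemma 7.28, Arapura Lemma 4.2).
[cite: VoisinHodgeI2002, §7.3.2 Lemma 7.28 and Remark 7.29, §11.3.3 Thm. 11.38–11.40, Lemma 11.41 and pp. 285–287] [cite: Arapura2006, §4 Lemma 4.2 (clause HC) and §1 Cor. 1.2] [cite: DeligneHodgeII1971, 2.1.13] [cite: Deligne2000, §1] -/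
theorem BettiUniverse.hodgeConjectureFor_tensor_iff_factors_and_forall_hom_reducedWindow_exists_crossMap_algebraic (hHD : exists_isReal_hodgeModel) (hY : IsSmoothProjective m Y)
    (hZ : IsSmoothProjective n Z) :
    HodgeConjectureFor (m + n) (Y ⊗ Z) ↔
      HodgeConjectureFor m Y ∧ HodgeConjectureFor n Z ∧
        ∀ (c i j a : ℕ) (r : ℤ) (_hc : 2 ≤ c) (_hi : 1 ≤ i) (_him : i ≤ m) (_hj : 1 ≤ j) (_hjn : j ≤ n) (hij : i + j = 2 * c) (_haj : a + j = 2 * n) (hab : a + 2 * c = i + 2 * n)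
          (_hr : ((n : ℕ) : ℤ) + r = ((c : ℕ) : ℤ)) (hw : ((i : ℕ) : ℤ) - 2 * r = ((a : ℕ) : ℤ))
          (_hbY : 0 < Module.finrank ℚ (bettiCohomology Y i)) (_hbZ : 0 < Module.finrank ℚ (bettiCohomology Z j))
          (_hnY : ∀ a', i = 2 * a' → (BettiUniverse.hodge hHD hY (2 * a')).hodgeClasses a' ≠ ⊤) (_hnZ : ∀ b', j = 2 * b' → (BettiUniverse.hodge hHD hZ (2 * b')).hodgeClasses b' ≠ ⊤)
          (φ : HodgeStructure.Hom (BettiUniverse.hodge hHD hZ a) (((BettiUniverse.hodge hHD hY i).tateTwist r).cast hw)),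
          ∃ t : bettiCohomology Y i ⊗[ℚ] bettiCohomology Z j, ofRatClass (ComplexPoints (Y ⊗ Z)) (2 * c) (BettiUniverse.crossMap Y Z hij t) ∈ algebraicClasses (Y ⊗ Z) c ∧
            ∀ v, corrAction complexOrientationFamily hY hZ hab (ofRatClass (ComplexPoints (Y ⊗ Z)) (2 * c) (BettiUniverse.crossMap Y Z hij t)) (ofRatClass (ComplexPoints Z) a v) =
              ofRatClass (ComplexPoints Y) i (φ.toLinearMap v) := by
  refine ⟨fun h ↦ ?_, fun h ↦ (BettiUniverse.hodgeConjectureFor_tensor_iff_forall_hom_reducedWindow_exists_crossMap_algebraic hHD hY hZ (hY.tensor_holds hZ) h.1 h.2.1).2 h.2.2⟩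
  have hHCY : HodgeConjectureFor m Y := hodgeConjectureFor_of_tensor_left hY hZ h
  have hHCZ : HodgeConjectureFor n Z := hodgeConjectureFor_of_tensor_right hY hZ h
  exact ⟨hHCY, hHCZ, (BettiUniverse.hodgeConjectureFor_tensor_iff_forall_hom_reducedWindow_exists_crossMap_algebraic hHD hY hZ (hY.tensor_holds hZ) hHCY hHCZ).1 h⟩

end Literature.AlgebraicGeometry.HodgeTheory

end
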